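import Summits.Langlands.Langlands.Theorems.QuadraticWindowHostInducedRepMemberSatake
import Literature.NumberTheory.GaloisRepresentations.HeckeCharacterExtensionQuadraticCMProofs
import HarnessLib

/-!
# `stub_memberSatake` WITHOUT the Hecke-character extension fact (line `one-transparent-pane`, crux
# `Summit.Langlands.Langlands.Theses.QuadraticWindow.HostInducedRep`; glue stmt-Langlands-16559)

Verbatim the landed `memberSatake_objects` / `stub_memberSatake` (…MemberSatakeObjects.lean,
…MemberSatake.lean), except that the input `hext` — the extension of unitary idele class characters along
the quadratic `K/F₀` with prescribed unramifiedness, the named fact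
`HewittRoss_heckeCharacter_extension_quadratic` (Hewitt–Ross (24.12)) — is NO LONGER a hypothesis: at its
only use (`χ₀ = (χe ω₀)⁻¹ μ` of finite order, `F₀` totally real by `Hyps`, `K` totally complex) it is the
tree's theorem `HeckeCharacter.exists_extension_quadratic_of_isTotallyComplex_of_isFiniteOrder`
(Literature/…/HeckeCharacterExtensionQuadraticCMProofs.lean, Weil's method, no duality).  The price is one
new explicit hypothesis `IsTotallyComplex K` (supplied downstream from `[IsCMField K]`).  Statements and
proofs are otherwise unchanged. [cite: ArthurClozelAMS120, Ch. 3 Thm. 4.2, 5.1, 6.2]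
-/

open scoped BigOperators Polynomial Classical
open Filter Set Polynomial IsDedekindDomain NumberField
open Literature.NumberTheory.Automorphic Literature.NumberTheory.GaloisRepresentations
open Literature.NumberTheory.QuadraticForms Literature.NumberTheory.QuadraticForms.QuadraticExtension
open Summit.Langlands.Langlands.Theorems.HostInducedRep.GrsExplicitDescent

-- `Summit.Langlands.Langlands.…` (summit = sub-problem name, D-0017 layout) trips `dupNamespace`.
set_option linter.dupNamespace false

noncomputable section

namespace Summit.Langlands.Langlands.Theorems.HostInducedRep.OneTransparentPane

section Objects

variable {F₀ F : Type} [Field F₀] [NumberField F₀] [Field F] [NumberField F] [Algebra F₀ F]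

/-- **The member objects and their relations without the extension fact** (`memberSatake_objects` with
`hext` discharged in the CM / finite-order case it uses; new hypothesis `IsTotallyComplex K`).
[cite: ArthurClozelAMS120, Ch. 3 Thm. 4.2, 5.1, 6.2] -/
theorem memberSatake_objects_cm (hAI : automorphicInduction_cyclic_cuspidal_unramified)
    (hBC : ∀ (n : ℕ) (F E : Type) [Field F] [NumberField F] [Field E] [NumberField E] [Algebra F E]
      [IsGalois F E], (Module.finrank F E).Prime →
      ∀ (hF : isCompact_glFiniteIntegralLevel n F) (π : CuspidalAutomorphicRepData n F hF),
        (∃ v : HeightOneSpectrum (𝓞 F), ¬ Algebra.IsUnramifiedIn (𝓞 E) v.asIdeal ∧ π.1.IsUnramifiedAt v) →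
        ∀ (hE : isCompact_glFiniteIntegralLevel n E),
          ∃ P : CuspidalAutomorphicRepData n E hE, IsUnramifiedBaseChangeLift π.1 P.1)
    (τ : F ≃ₐ[F₀] F) (n : ℕ) (hcpt : isCompact_glFiniteIntegralLevel n F)
    (π : CuspidalAutomorphicRepData n F hcpt) (e : FramedGaloisRep F₀ ℂ 1) (k : ℤ) (ℓ : ℕ) [Fact ℓ.Prime]
    (ι : PadicAlgCl ℓ ≃+* ℂ) (eψ : FramedGaloisRep F ℂ 1) (hH : Hyps τ n π e k ℓ eψ)
    (K : Type) [Field K] [NumberField K] [Algebra F₀ K] (cK : K ≃ₐ[F₀] K) (h2K : Module.finrank F₀ K = 2)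
    (hcK : cK ≠ 1) (hKc : IsTotallyComplex K)
    (hram : ∃ v₀ : HeightOneSpectrum (𝓞 F₀), ¬ Algebra.IsUnramifiedIn (𝓞 K) v₀.asIdeal ∧
      ∃ (α : HeightOneSpectrum (𝓞 F) → Multiset ℂ) (c : HeightOneSpectrum (𝓞 F) → ℂ), Guard π eψ v₀ α c)
    (L F' : Type) [Field L] [NumberField L] [Field F'] [NumberField F'] [Algebra F₀ L] [Algebra F L]
    [Algebra K L] [Algebra F' L] [IsScalarTower F₀ F L] [IsScalarTower F₀ K L] [IsGalois K L]
    (s : L ≃ₐ[F'] L) (hT : IsPaneTower τ cK L F' s) (χe : HeckeCharacter F₀) (ω : HeckeCharacter F)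
    (hfin : ω.IsFiniteOrder) (ω₀ : HeckeCharacter F₀)
    (hχe : ∀ v : HeightOneSpectrum (𝓞 F₀), e.IsUnramifiedAt v →
      χe.IsUnramifiedAt v ∧ e.HasFrobCharpolyAt v (X - C (χe.valueAtUniformizer v)))
    (hχefin : χe.IsFiniteOrder)
    (hω : ∀ w : HeightOneSpectrum (𝓞 F), eψ.IsUnramifiedAt w →
      ω.IsUnramifiedAt w ∧ eψ.HasFrobCharpolyAt w (X - C (ω.valueAtUniformizer w)))
    (hω₀ : ∀ x, ω₀ x = ω (AdeleRing.ideleBaseChange F₀ F x)) (μ : HeckeCharacter F₀) (hμ : MuHyp F K μ) :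
    ∃ (ψu νk ν : HeckeCharacter K)
      (Pind : CuspidalAutomorphicRepData (2 * n) F₀ (isCompact_glFiniteIntegralLevel_holds (2 * n) F₀))
      (PiK τ' : CuspidalAutomorphicRepData (2 * n) K (isCompact_glFiniteIntegralLevel_holds (2 * n) K))
      (P₀ P : CuspidalAutomorphicRepData n L (isCompact_glFiniteIntegralLevel_holds n L)),
      MemberRel π e eψ k μ χe ω hfin ω₀ ψu νk ν Pind PiK τ' P₀ P ∧
      (∀ u : HeightOneSpectrum (𝓞 K), ((χe * ω₀)⁻¹ * μ).IsUnramifiedAt (u.under (𝓞 F₀)) →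
        ψu.IsUnramifiedAt u) ∧
      (∀ (v : HeightOneSpectrum (𝓞 F₀)) (α : HeightOneSpectrum (𝓞 F) → Multiset ℂ)
          (c : HeightOneSpectrum (𝓞 F) → ℂ), Guard π eψ v α c →
          (v.asIdeal.primesOver (𝓞 K)).ncard = 2 →
          ∃ u : HeightOneSpectrum (𝓞 K), u.under (𝓞 F₀) = v ∧ (ψu * νk * ν).IsUnramifiedAt u ∧
            ∃ β : Multiset ℂ, τ'.1.HasSatakeParamAt u β ∧
              arithFrobPolyOfSatake ι u.residueCard (2 * n)
                  (β.map (fun b ↦ b * ((ψu * νk * ν).valueAtUniformizer u)⁻¹)) = hostPoly ι n α c v) := by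
  have hn : 0 < n := hyps_rank_pos hH
  haveI : NeZero n := ⟨hn.ne'⟩
  haveI : NeZero (2 * n) := ⟨by omega⟩
  have hdeg : Module.finrank F₀ F = 2 := hH.2.1
  haveI : Algebra.IsQuadraticExtension F₀ K := ⟨h2K⟩
  haveI : IsGalois F₀ K := Algebra.IsQuadraticExtension.isGalois F₀ K
  haveI : Algebra.IsQuadraticExtension F L := ⟨hT.1⟩
  haveI : IsGalois F L := Algebra.IsQuadraticExtension.isGalois F L
  -- `χ₀` has finite order, hence is unitary
  have hω₀fin : ω₀.IsFiniteOrder := isFiniteOrder_of_restrict hω₀ hfin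
  have hχ₀fin : ((χe * ω₀)⁻¹ * μ).IsFiniteOrder := by
    change IsOfFinOrder _
    exact ((IsOfFinOrder.mul hχefin hω₀fin).inv).mul hμ.1
  -- the set `U` and the unitary extension `ψu`
  choose pick hpick using fun v : HeightOneSpectrum (𝓞 F₀) ↦ HeightOneSpectrum.exists_under_eq K v
  obtain ⟨ψu, hψuU, hψures, hψuunr⟩ :=
    HeckeCharacter.exists_extension_quadratic_of_isTotallyComplex_of_isFiniteOrder F₀ K cK h2K hcK hH.1 hKc
      ((χe * ω₀)⁻¹ * μ) hχ₀fin _ (admissible_of_pick cK ((χe * ω₀)⁻¹ * μ) pick)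
  -- the norm powers
  obtain ⟨νk, hνk⟩ := exists_heckeCharacter_ideleNorm_cpow (K := K) ((k : ℂ) / 2)
  obtain ⟨ν, hν⟩ := exists_heckeCharacter_ideleNorm_cpow (K := K) (-(n : ℂ) / 2)
  -- the induced package `Pind = AI(π ⊗ ω)`
  obtain ⟨Pind, hPind, hIP, hAIae⟩ := exists_inducedPackage_avatar hAI hH hfin hω
  -- the strong base change `PiK` to `K` (`Pind` is unramified at the ramified guarded `v₀`)
  obtain ⟨v₀, hv₀, α₀, c₀, hg₀⟩ := hram
  obtain ⟨B₀, hB₀, -⟩ := hIP v₀ α₀ c₀ hg₀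
  obtain ⟨PiK, hPiK⟩ := hBC (2 * n) F₀ K (h2K ▸ Nat.prime_two) _ Pind ⟨v₀, hv₀, B₀, hB₀⟩
    (isCompact_glFiniteIntegralLevel_holds (2 * n) K)
  -- the twist `τ' = PiK ⊗ (ψu νk)`
  obtain ⟨τ', hτ'W, hτ'W'⟩ := exists_cuspidalAutomorphicRepData_twist_hecke (ψu * νk) PiK
  -- the strong base change `P₀` of `π ⊗ ω` to `L` (a place of `F` over `v₀` is ramified in `L`)
  obtain ⟨𝔓₀, h𝔓₀⟩ := HeightOneSpectrum.exists_under_eq L v₀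
  have hw₀v : (𝔓₀.under (𝓞 F)).under (𝓞 F₀) = v₀ := (under_under_place 𝔓₀).trans h𝔓₀
  have hw₀unr : (π.twist ω hfin).1.IsUnramifiedAt (𝔓₀.under (𝓞 F)) := by
    obtain ⟨-, hsat, hunr, -⟩ := hg₀ _ hw₀v
    exact ⟨_, hasSatakeParamAt_twist_at_unramified_place hsat hfin (hω _ hunr).1⟩
  have hw₀ram : ¬ Algebra.IsUnramifiedIn (𝓞 L) (𝔓₀.under (𝓞 F)).asIdeal :=
    not_isUnramifiedIn_under_of_tower 𝔓₀ h𝔓₀ hv₀ fun w hw ↦ (hg₀ w hw).1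
  obtain ⟨P₀, hP₀⟩ := hBC n F L (hT.1 ▸ Nat.prime_two) hcpt (π.twist ω hfin)
    ⟨_, hw₀ram, hw₀unr⟩ (isCompact_glFiniteIntegralLevel_holds n L)
  -- the twist `P = P₀ ⊗ ((ψu νk) ∘ N_{L/K})`
  obtain ⟨P, hPW, hPW'⟩ :=
    exists_cuspidalAutomorphicRepData_twist_hecke ((ψu * νk).compRelNorm L) P₀
  refine ⟨ψu, νk, ν, Pind, PiK, τ', P₀, P, ⟨hχe, hχefin, hω, hω₀, hχ₀fin, hψuU, hψures, hνk, hν, hAIae,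
    hPiK.isWeakBaseChangeLiftAE, hτ'W, hτ'W', hP₀.isWeakBaseChangeLiftAE, hPW, hPW'⟩,
    fun u hu ↦ hψuunr u (Or.inl hu), fun v α c hg hsplit ↦ ?_⟩
  -- COVERAGE at the chosen place `u = pick v` over a guarded `v` split in `K`
  have hef := ramificationIdx_inertiaDeg_eq_one_of_ncard v (hsplit.trans h2K.symm)
  have hvK : Algebra.IsUnramifiedIn (𝓞 K) v.asIdeal :=
    isUnramifiedIn_of_forall_ramificationIdx_eq_one v fun u hu ↦ (hef u hu).1
  have hne : cK • pick v ≠ pick v := by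
    refine smul_ne_of_ncard_eq_two (K := F₀) (E := K) (v := v) ?_ hcK (hpick v)
    rw [ncard_finitePlacesOver_eq_ncard_primesOver, hsplit]
  have hmem : pick v ∈ {u : HeightOneSpectrum (𝓞 K) | ((χe * ω₀)⁻¹ * μ).IsUnramifiedAt (u.under (𝓞 F₀)) ∨
      (u = pick (u.under (𝓞 F₀)) ∧ cK • u ≠ u)} := Or.inr ⟨by rw [hpick v], hne⟩
  have hψ₀u : (ψu * νk).IsUnramifiedAt (pick v) :=
    parity_isUnramifiedAt_mul (hψuunr _ hmem) (HeckeCharacter.IsNormTwist.isUnramifiedAt_holds ⟨_, hνk⟩ _)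
  obtain ⟨B, hB, hBi⟩ := hIP v α c hg
  exact ⟨pick v, hpick v, member_dictionary_split ι n Pind.1 PiK.1 τ'.1 (ψu * νk) ν hν hτ'W hτ'W'
    hPiK (hpick v) hvK (hef _ (hpick v)).2 hB hBi hψ₀u⟩

end Objects

/-- **Sub-stub SATAKE without the extension fact** (`stub_memberSatake` with `hext` discharged; new
hypothesis `IsTotallyComplex K` after `cK ≠ 1`). [cite: ArthurClozelAMS120, Ch. 3 Thm. 4.2, 5.1, 6.2] -/
theorem stub_memberSatake_cm : automorphicInduction_cyclic_cuspidal_unramified → (∀ (n : ℕ) (F E : Type) [Field F] [NumberField F] [Field E] [NumberField E] [Algebra F E] [IsGalois F E], (Module.finrank F E).Prime → ∀ (hF : isCompact_glFiniteIntegralLevel n F) (π : CuspidalAutomorphicRepData n F hF), (∃ v : HeightOneSpectrum (𝓞 F), ¬ Algebra.IsUnramifiedIn (𝓞 E) v.asIdeal ∧ π.1.IsUnramifiedAt v) → ∀ (hE : isCompact_glFiniteIntegralLevel n E), ∃ P : CuspidalAutomorphicRepData n E hE, IsUnramifiedBaseChangeLift π.1 P.1) → ∀ (F₀ F : Type) [Field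 F₀] [NumberField F₀] [Field F] [NumberField F] [Algebra F₀ F] (τ : F ≃ₐ[F₀] F) (n : ℕ) (hcpt : isCompact_glFiniteIntegralLevel n F) (π : CuspidalAutomorphicRepData n F hcpt) (e : FramedGaloisRep F₀ ℂ 1) (k : ℤ) (ℓ : ℕ) [Fact ℓ.Prime] (ι : PadicAlgCl ℓ ≃+* ℂ) (eψ : FramedGaloisRep F ℂ 1), Hyps τ n π e k ℓ eψ → ∀ (K : Type) [Field K] [NumberField K] [Algebra F₀ K] (cK : K ≃ₐ[F₀] K), Module.finrank F₀ K = 2 → cK ≠ 1 → IsTotallyComplex K → (∃ v₀ : HeightOneSpectrum (𝓞 F₀), ¬ Algebra.IsUnramifiedIn (𝓞 K) v₀.asIdeal ∧ ∃ (α : HeightOneSpectrum (𝓞 F) → Multiset ℂ) (c : HeightOneSpectrum (𝓞 F) → ℂ), Guard π eψ v₀ α c) → ∀ (L F' : Type) [Field L] [NumberField L] [Field F'] [NumberField F'] [Algebra F₀ L] [Algebra F L] [Algebra K L] [Algebra F' L] [IsScalarTower F₀ F L] [IsScalarTower F₀ K L] [IsGalois K L] (s : L ≃ₐ[F'] L),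 IsPaneTower τ cK L F' s → ∀ (χe : HeckeCharacter F₀) (ω : HeckeCharacter F) (hfin : ω.IsFiniteOrder) (ω₀ : HeckeCharacter F₀), (∀ v : HeightOneSpectrum (𝓞 F₀), e.IsUnramifiedAt v → χe.IsUnramifiedAt v ∧ e.HasFrobCharpolyAt v (X - C (χe.valueAtUniformizer v))) → χe.IsFiniteOrder → (∀ w : HeightOneSpectrum (𝓞 F), eψ.IsUnramifiedAt w → ω.IsUnramifiedAt w ∧ eψ.HasFrobCharpolyAt w (X - C (ω.valueAtUniformizer w))) → (∀ x, ω₀ x = ω (AdeleRing.ideleBaseChange F₀ F x)) → ∀ (μ : HeckeCharacter F₀), MuHyp F K μ → ∃ (ψu νk ν : HeckeCharacter K) (Pind : CuspidalAutomorphicRepData (2 * n) F₀ (isCompact_glFiniteIntegralLevel_holds (2 * n) F₀)) (PiK τ' : CuspidalAutomorphicRepData (2 * n) K (isCompact_glFiniteIntegralLevel_holds (2 * n) K)) (P₀ P : CuspidalAutomorphicRepData n L (isCompact_glFiniteIntegralLevel_holds n L)), MemberRel π e eψ k μ χe ω hfin ω₀ ψu νk ν Pind PiK τ' P₀ P ∧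 SatakeOut F₀ π ι eψ cK s τ'.1 (ψu * νk * ν) P.1 := by
  intro hAI hBC F₀ F _ _ _ _ _ τ n hcpt π e k ℓ _ ι eψ hH K _ _ _ cK h2K hcK hKc hram L F' _ _ _ _ _ _ _ _ _ _ _ s hT
    χe ω hfin ω₀ hχe hχefin hω hω₀ μ hμ
  obtain ⟨ψu, νk, ν, Pind, PiK, τ', P₀, P, hrel, -, hcov⟩ := memberSatake_objects_cm hAI hBC τ n hcpt π e
    k ℓ ι eψ hH K cK h2K hcK hKc hram L F' s hT χe ω hfin ω₀ hχe hχefin hω hω₀ μ hμ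
  refine ⟨ψu, νk, ν, Pind, PiK, τ', P₀, P, hrel, ?_⟩
  obtain ⟨-, -, -, -, -, -, hψures, hνk, hν, hAIae, hBCae, hτ'W, hτ'W', hP₀BC, hPW, hPW'⟩ := hrel
  obtain ⟨-, hdeg, hτ, -, hpol, -⟩ := hH
  exact ⟨⟨memberDict_ae π eψ ι hfin hω hνk hν hAIae hBCae hτ'W hτ'W', hcov⟩,
    isConjSelfDualAE_tau hdeg hτ h2K hcK π e k hpol hfin hχe hω₀ hμ hψures hνk hAIae hBCae hτ'W hτ'W',
    isConjSelfDualAE_pane hdeg hτ h2K hcK hT π e k hpol hfin hχe hω₀ hμ hψures hνk hAIae hBCae hτ'W hτ'W'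
      hP₀BC hPW hPW',
    isAutomorphicInductionAlong_pane hdeg hτ h2K hcK hT π e k hpol hfin hχe hω₀ hμ hψures hAIae hBCae
      hτ'W hτ'W' hP₀BC hPW hPW'⟩

end Summit.Langlands.Langlands.Theorems.HostInducedRep.OneTransparentPane

end
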